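import Literature.MathematicalPhysics.QuantumFieldTheory.Balaban1983to89.B7Prop3GeneralRotated

/-!
# `Balaban1983to89.B7Eq14LinearAverage` — T. Bałaban, *Averaging operations for lattice gauge theories*, Commun. Math.
Phys. **98** (1985) 17–51 [Balaban1985Averaging], Introduction pp. 19–20 [PDF 3–4]: **the linear averaging operation (14)
`Ā_c` (= [2] (1.8)) WITH ITS BODY on the `ℤᵈ` carrier, and the sentence after (15) — "expanding the logarithm … we get the
expression (14) as a linear term" — as a kernel theorem** (the derivative of `log Ū_c` along `U = e^{tA}` at `t = 0`)

statement-level skeleton of published theorems with citation tags; proofs where landed; nothing here is a claim about the Yang–Mills mass gap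

PDF held: `paper:balaban1985-cmp98-averaging` (journal page = PDF page + 16); renders
`pub-balaban/b2b-balaban-ref1/pages/1985-cmp98-averaging/1985-cmp98-averaging-p003-x2.png` (p. 19), `…-p004-x2.png` (p. 20),
`…-p009-x2.png` (p. 25) read as images by the typing seat (unit `lit-balaban-r04`, gen 52); [2] = T. Bałaban, *Propagators and
renormalization transformations for lattice gauge theories. I*, Commun. Math. Phys. **95** (1984) 17–40 [Balaban1984PropagatorsI]
(`paper:balaban1984-cmp95-propagators-rt-i`, journal page = PDF page + 16), p. 19 text layer.

CITATION HEADER / PRINT, verbatim.  B7 p. 19: "A second condition on averages `Ū` is formulated in the following way. We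
consider configurations `U` with values in a small neighborhood of the identity of `G`, hence `U = e^{iA}` and `A` is a Lie
algebra valued configuration with values in a small neighborhood of `0`. For such configurations we demand that `(1/i) log Ū`
is well approximated by the linear averaging operation (1.8) defined in [2]. Let us write this operation
`Ā_c = Σ_{x∈B(c₋)} L^{−(d+1)}(A(Γ_{c₋,x}) + A([x, x(c)]) + A(Γ_{x(c),c₊})).` (14)
We refer the reader to paper [2] for explanations of symbols used above. Let us notice that `Γ_{c₋,x}∪[x, x(c)]∪Γ_{x(c),c₊}`
is an oriented contour with `c₋` as an initial point and `c₊` as a final point. We denote it by `Γ_{c,x}`."  (15):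
"`Ū_c = exp[i Σ_{x∈B(c₋)} L^{−d} (1/i) log U(Γ_{c,x})U(c)⁻¹]U(c), c ⊂ Ω^{(1)},`".  p. 20, first sentence: "It is easy to see
that taking `U = e^{iA}` with `A` small and expanding the logarithm of the expression on the right-hand side above in powers
of `A`, we get the expression (14) as a linear term in the expansion."  [2] p. 19 (1.8): "`B_c = Σ_{x∈B(c₋)} L^{−(d+1)}(A(Γ_{c₋,x})
+ A([x, x(c)]) + A(Γ_{x(c),c₊}))`, (1.8) where `A(Γ) = Σ_{b⊂Γ} A_b` for arbitrary contour `Γ`, and `x(c)` denotes a point in the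
block `B(c₊)` obtained by translation of `x` by the bond `c`, so if `c = ⟨y, y + Le_μ⟩` then `x(c) = x + Le_μ`."; (1.9): "`B^λ_c =
B_c − L⁻¹(λ(c₊) − λ(c₋)) = B_c − (∂λ)(c)`"; (1.11): "`(QA)_c = Σ_{x∈B(c₋)} L^{−(d+1)} A([x, x(c)])`".  B7 p. 25 (Sect. B, the
displays before (47)): "`|V̄_{0,c} − 1 − i Σ_{x∈B(c₋)} L^{−d} A(Γ_{c,x})| < O(1)(L²α₀)²`".

DICTIONARY print ↦ Lean (the b07 lineage's concrete unit-lattice model `B7Prop1Explicit`: `Ω ↦ ℤᵈ = Site d`, `G ⊂ U(N) ↦`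
the units of a complete normed `ℂ`-algebra `𝔸`, print's `i·(1/i)` absorbed — `U = e^{iA} ↦ expCfg A = (e^{A_b})_b`).  The
`L`-bond `c = ⟨q, q + Le_κ⟩` is `(q, κ)`, `c₋ = q`, `c₊ = q + Le_κ`; `x = q + r ∈ B(c₋)`, `r = boxVec L r′ ∈ [0, L)ᵈ`;
`Γ_{c₋,x} = treeWord r` from `q` ([2] (1.7)); `[x, x(c)] = seg κ L` from `x`; `Γ_{x(c),c₊}` = the contour `Γ_{c₊,x(c)}` run
backwards = `revWord (treeWord r)` from `x(c) = x + Le_κ`; `A(Γ) = asum A · Γ` (signed, (9)); `Γ_{c,x} = gammaWord L κ r`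
(`B7Prop1Explicit.gammaWord`, whose docstring quotes (14)); `Σ_{x∈B(c₋)} L^{−d} A(Γ_{c,x}) = B7Prop1Explicit.Tside L A q κ`
((47)–(49)); `(QA)_c` of [2] (1.11) = (125) = `B7Prop3Flat.Q0form`; `Σ_{x∈B(y)} L^{−d}A(Γ_{y,x}) = B7Prop3Flat.Fhat`.

WHAT THIS FILE ADDS (kernel, 0 sorry, standard axioms; ONE definition with print's body, no `def … : Prop`).
* §1 **`linAvg L A q κ`** := the right-hand side of (14) verbatim (three terms per site of the block, weight `L^{−(d+1)}`);
  `linAvg_eq_sum_gammaWord` ("We denote it by `Γ_{c,x}`": `Ā_c = Σ_x L^{−(d+1)} A(Γ_{c,x})`); `Tside_eq_smul_linAvg`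
  (`Σ_x L^{−d}A(Γ_{c,x}) = L·Ā_c`); `linAvg_eq_Q0form_add` (`Ā_c = (QA)_c + L⁻¹(F̂(c₋) − F̂(c₊))` — [2]'s (1.8) against (1.11),
  the tree legs; from `B7Prop3Flat.frame_cancellation`); `linAvg_csmul` (linearity in `A`).
* §2 the p. 20 sentence as an EXACT DERIVATIVE along the ray `U = e^{tA}`, `t ∈ ℂ`, for every bond field `A` on `ℤᵈ` and
  every `L ≥ 1` (no smallness needed for a derivative at `0`): `hasDerivAt_hol_expCfg` (`d/dt|₀ e^{tA}(Γ) = A(Γ)`),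
  `hasDerivAt_Xavg_expCfg` (the exponent of (15)/(42): `d/dt|₀ X_c = X̂_c = B7Prop1Explicit.Xhat`, p. 25),
  `hasDerivAt_bavg_expCfg` (`d/dt|₀ Ū_c = T_c`), **`hasDerivAt_mlog_bavg_expCfg`** (`d/dt|₀ log Ū_c(e^{tA}) = T_c =
  Σ_{x∈B(c₋)} L^{−d} A(Γ_{c,x})`) and **`hasDerivAt_mlog_bavg_expCfg_linAvg`** (`= L·Ā_c`); with print's `i` restored,
  **`hasDerivAt_invI_smul_mlog_bavg`** (`d/ds|₀ (1/i) log Ū_c(e^{isA}) = L·Ā_c`) and its real-parameter form `…_real`.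
NORMALISATION (recorded, not adjudicated).  On the carrier of record the linear term of `(1/i) log Ū_c` is the BOND quantity
`Σ_x L^{−d}A(Γ_{c,x}) = L·Ā_c`; (14) = [2] (1.8) carries the extra `L⁻¹` because [2] writes the averaged field in the
function normalisation of its (1.1) on the `L`-lattice (bond variable ÷ bond length `L`; cf. [2] (1.9) `(∂λ)(c) = L⁻¹(λ(c₊) −
λ(c₋))`), and print itself uses both weights for the same operator (`L^{−d}` in `(Q₀A)(c)` p. 28, `L^{−(d+1)}` in (125) p. 36;
the tree's `B7Prop3Flat.linQ_eq_smul_Q0form`).  The theorems below state the factor explicitly.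
SECOND ORDER.  The quantitative form of the sentence (remainder `O(|A|²)`) is the lineage's `B7Prop1Explicit.side_estimate`
(`|V̄_{0,c} − 1 − T_c| ≤ 50θ²`, p. 25) and, for `log` of the double-bar average, `B7Prop3Flat.mlog_dbavg_sub_linQ_le_of_bound`;
not repeated here.
Owner audit context: ROWS-B7 row `B7.Eq14` ((14)); this member supplies (a) the display WITH ITS BODY and (b) the one sentence
print states about it, under the reading rule for definition displays.  Unit `lit-balaban-r04` gen 52, 2026-08-23.
-/

noncomputable section

open scoped BigOperators
open NormedSpace Finset

namespace Literature.MathematicalPhysics.QuantumFieldTheory.Balaban1983to89.B7Eq14LinearAverage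

open B7Prop1Explicit B7Prop3Flat MatrixLog
open B7Eq78Linearization (hasDerivAt_mlog_comp hasDerivAt_exp_comp_zero)
open B7Prop3GeneralRotated (hasDerivAt_hol_expCfg_mul tsum_one_left expCfg_zero)
open B8Ineq130 (hol_one Wcx_one bavg_one)

-- `Site` alone would resolve to the torus sites of `Setup.lean`; re-export the `ℤ^d` sites of `B7Prop1Explicit`.
export B7Prop1Explicit (Site)

variable {d : ℕ}
variable {𝔸 : Type*} [NormedRing 𝔸] [NormedAlgebra ℂ 𝔸] [CompleteSpace 𝔸]
variable (L : ℕ)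

/-! ## §1 (14): the linear averaging operation `Ā_c`, with its body -/

section Def

/-- **(14)** p. 19, verbatim: "`Ā_c = Σ_{x∈B(c₋)} L^{−(d+1)}(A(Γ_{c₋,x}) + A([x, x(c)]) + A(Γ_{x(c),c₊}))`" — the linear
averaging operation (1.8) of [2], for the `L`-bond `c = ⟨q, q + Le_κ⟩` of the `L`-lattice and a bond field `A` on `ℤᵈ`:
the sum over `x = q + r ∈ B(c₋)` (`r ∈ [0, L)ᵈ`) of `L^{−(d+1)}` times [`A` along the tree contour `Γ_{c₋,x}` from `c₋`] +
[`A` along the straight segment `[x, x(c)]`, `x(c) = x + Le_κ`] + [`A` along `Γ_{x(c),c₊}` = `Γ_{c₊,x(c)}` run backwards,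
from `x(c)` to `c₊`]. [cite: Balaban1985Averaging, (14) p.19; Balaban1984PropagatorsI, (1.8) p.19] -/
def linAvg (A : Site d → Fin d → 𝔸) (q : Site d) (κ : Fin d) : 𝔸 :=
  ∑ r : Fin d → Fin L, (((L : ℝ) ^ (d + 1))⁻¹) •
    (asum A q (treeWord (boxVec L r)) + asum A (q + boxVec L r) (seg κ L)
      + asum A (q + boxVec L r + (L : ℤ) • e κ) (revWord (treeWord (boxVec L r))))

omit [CompleteSpace 𝔸] in
/-- "Let us notice that `Γ_{c₋,x}∪[x, x(c)]∪Γ_{x(c),c₊}` is an oriented contour with `c₋` as an initial point and `c₊` as a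
final point. We denote it by `Γ_{c,x}`" (p. 19): `Ā_c = Σ_{x∈B(c₋)} L^{−(d+1)} A(Γ_{c,x})` with the lineage's word
`Γ_{c,x} = gammaWord L κ r`. [cite: Balaban1985Averaging, (14) p.19] -/
theorem linAvg_eq_sum_gammaWord (A : Site d → Fin d → 𝔸) (q : Site d) (κ : Fin d) :
    linAvg L A q κ = ∑ r : Fin d → Fin L, (((L : ℝ) ^ (d + 1))⁻¹) • asum A q (gammaWord L κ (boxVec L r)) := by
  unfold linAvg
  refine Finset.sum_congr rfl fun r _ => ?_
  rw [gammaWord, asum_append, asum_append, disp_append, disp_treeWord, disp_seg, ← add_assoc q]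

omit [CompleteSpace 𝔸] in
/-- `Σ_{x∈B(c₋)} L^{−d} A(Γ_{c,x}) = L·Ā_c`: the first-order term `T_c` of `V̄_c` (p. 25, `B7Prop1Explicit.Tside`) is `L`
times (14) (`L ≥ 1`). [cite: Balaban1985Averaging, (14) p.19, p.25 (displays before (47))] -/
theorem Tside_eq_smul_linAvg (hL : 1 ≤ L) (A : Site d → Fin d → 𝔸) (q : Site d) (κ : Fin d) :
    Tside L A q κ = (L : ℝ) • linAvg L A q κ := by
  rw [linAvg_eq_sum_gammaWord, Tside, Finset.smul_sum]
  refine Finset.sum_congr rfl fun r _ => ?_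
  rw [smul_smul]
  congr 1
  have hL0 : (L : ℝ) ≠ 0 := by exact_mod_cast (by omega : L ≠ 0)
  rw [pow_succ]
  field_simp

omit [CompleteSpace 𝔸] in
/-- (14) = [2] (1.8) against [2] (1.11) = (125): `Ā_c = (QA)_c + L⁻¹(F̂(c₋) − F̂(c₊))`, `F̂(y) = Σ_{x∈B(y)} L^{−d}A(Γ_{y,x})`
— the straight-segment operator plus the two tree legs (`B7Prop3Flat.frame_cancellation` divided by `L`). [cite: Balaban1985Averaging, (14) p.19, (125) p.36; Balaban1984PropagatorsI, (1.8) + (1.11) p.19] -/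
theorem linAvg_eq_Q0form_add (hL : 1 ≤ L) (A : Site d → Fin d → 𝔸) (q : Site d) (κ : Fin d) :
    linAvg L A q κ = Q0form L A q κ + (L : ℝ)⁻¹ • (Fhat L A q - Fhat L A (q + (L : ℤ) • e κ)) := by
  have hL0 : (L : ℝ) ≠ 0 := by exact_mod_cast (by omega : L ≠ 0)
  have hT : Tside L A q κ = Fhat L A q + linQ L A q κ - Fhat L A (q + (L : ℤ) • e κ) := by
    rw [← frame_cancellation]; abel
  have h : linAvg L A q κ = (L : ℝ)⁻¹ • Tside L A q κ := by
    rw [Tside_eq_smul_linAvg L hL, smul_smul, inv_mul_cancel₀ hL0, one_smul]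
  rw [h, hT, linQ_eq_smul_Q0form L hL]
  simp only [smul_sub, smul_add, smul_smul, inv_mul_cancel₀ hL0, one_smul]
  abel

omit [CompleteSpace 𝔸] in
/-- (14) is a `ℂ`-linear operation on bond fields: `\overline{tA}_c = t·Ā_c`. [cite: Balaban1985Averaging, (14) p.19] -/
theorem linAvg_csmul (t : ℂ) (A : Site d → Fin d → 𝔸) (q : Site d) (κ : Fin d) :
    linAvg L (t • A) q κ = t • linAvg L A q κ := by
  simp only [linAvg_eq_sum_gammaWord, asum_csmul, Finset.smul_sum, smul_comm t]

omit [CompleteSpace 𝔸] in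
/-- `T_c` is `ℂ`-linear in `A`. [cite: Balaban1985Averaging, p.25 (displays before (47))] -/
theorem Tside_csmul (t : ℂ) (A : Site d → Fin d → 𝔸) (q : Site d) (κ : Fin d) :
    Tside L (t • A) q κ = t • Tside L A q κ := by
  simp only [Tside, asum_csmul, Finset.smul_sum, smul_comm t]

end Def

/-! ## §2 p. 20: "(14) as a linear term in the expansion" of `log Ū_c`, `U = e^{iA}` — the derivative at `A = 0` -/

section Deriv

omit [CompleteSpace 𝔸] in
/-- The exponent `X_c` of the average (15)/(42) vanishes at the unit configuration. [folklore] -/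
private theorem Xavg_one (q : Site d) (κ : Fin d) : Xavg L (1 : Site d → Fin d → 𝔸ˣ) q κ = 0 := by
  simp [Xavg, Wcx_one, mlog_one]

/-- `d/dt|₀ e^{tA}(Γ) = A(Γ)` for every word `Γ` (the product (9) of the bond variables `e^{±tA_b}` differentiated at
`t = 0`; the flat case `V₀ = 1` of `B7Prop3GeneralRotated.hasDerivAt_hol_expCfg_mul`). [cite: Balaban1985Averaging, (9) p.18, (111) p.34] -/
theorem hasDerivAt_hol_expCfg (A : Site d → Fin d → 𝔸) (x : Site d) (w : List (Letter d)) :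
    HasDerivAt (fun t : ℂ => ((hol (expCfg (t • A)) x w : 𝔸ˣ) : 𝔸)) (asum A x w) 0 := by
  have h := hasDerivAt_hol_expCfg_mul (1 : Site d → Fin d → 𝔸ˣ) A x w
  simp only [mul_one, tsum_one_left, hol_one, Units.val_one] at h
  exact h

/-- `d/dt|₀ [e^{tA}(Γ_{c,x}) e^{tA}(c)⁻¹] = A(Γ_{c,x} ∪ (−c))` — the argument of `log` in (15)/(42) along the ray. [cite: Balaban1985Averaging, (15) p.19, (42) p.23] -/
theorem hasDerivAt_Wcx_expCfg (A : Site d → Fin d → 𝔸) (q : Site d) (κ : Fin d) (r : Site d) :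
    HasDerivAt (fun t : ℂ => ((Wcx L (expCfg (t • A)) q κ r : 𝔸ˣ) : 𝔸))
      (asum A q (gammaWord L κ r ++ seg κ (-(L : ℤ)))) 0 := by
  simp only [Wcx_eq_hol_loop]
  exact hasDerivAt_hol_expCfg A q _

/-- `d/dt|₀ log[e^{tA}(Γ_{c,x}) e^{tA}(c)⁻¹] = A(Γ_{c,x} ∪ (−c))` ("expanding the logarithm", `d log|₁ = id`). [cite: Balaban1985Averaging, p.20 (sentence after (15)), (15) p.19] -/
theorem hasDerivAt_mlog_Wcx_expCfg (A : Site d → Fin d → 𝔸) (q : Site d) (κ : Fin d) (r : Site d) :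
    HasDerivAt (fun t : ℂ => mlog ((Wcx L (expCfg (t • A)) q κ r : 𝔸ˣ) : 𝔸))
      (asum A q (gammaWord L κ r ++ seg κ (-(L : ℤ)))) 0 :=
  hasDerivAt_mlog_comp (by simp only [zero_smul, expCfg_zero, Wcx_one, Units.val_one])
    (hasDerivAt_Wcx_expCfg L A q κ r)

/-- The exponent of (15)/(42) to first order: `d/dt|₀ X_c(e^{tA}) = X̂_c = Σ_{x∈B(c₋)} L^{−d} A(Γ_{c,x} ∪ (−c))`
(`B7Prop1Explicit.Xhat`, p. 25). [cite: Balaban1985Averaging, p.25 (displays before (47)), (15) p.19] -/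
theorem hasDerivAt_Xavg_expCfg (A : Site d → Fin d → 𝔸) (q : Site d) (κ : Fin d) :
    HasDerivAt (fun t : ℂ => Xavg L (expCfg (t • A)) q κ) (Xhat L A q κ) 0 := by
  unfold Xavg Xhat
  refine HasDerivAt.fun_sum fun r _ => ?_
  exact (hasDerivAt_mlog_Wcx_expCfg L A q κ (boxVec L r)).const_smul (((L : ℝ) ^ d)⁻¹)

/-- **`d/dt|₀ Ū_c(e^{tA}) = T_c = Σ_{x∈B(c₋)} L^{−d} A(Γ_{c,x})`** — the average (15) = (42) to first order (p. 25:
"`|V̄_{0,c} − 1 − i Σ_{x∈B(c₋)} L^{−d} A(Γ_{c,x})| < O(1)(L²α₀)²`", here as the exact derivative; `L ≥ 1`). [cite: Balaban1985Averaging, p.25 (displays before (47)), (15) p.19] -/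
theorem hasDerivAt_bavg_expCfg (hL : 1 ≤ L) (A : Site d → Fin d → 𝔸) (q : Site d) (κ : Fin d) :
    HasDerivAt (fun t : ℂ => ((bavg L (expCfg (t • A)) q κ : 𝔸ˣ) : 𝔸)) (Tside L A q κ) 0 := by
  have h1 : HasDerivAt (fun t : ℂ => exp (Xavg L (expCfg (t • A)) q κ)) (Xhat L A q κ) 0 :=
    hasDerivAt_exp_comp_zero (by simp only [zero_smul, expCfg_zero, Xavg_one]) (hasDerivAt_Xavg_expCfg L A q κ)
  have h2 := hasDerivAt_hol_expCfg A q (seg κ (L : ℤ))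
  have h := h1.fun_mul h2
  simp only [zero_smul, expCfg_zero, hol_one, Units.val_one, mul_one, Xavg_one, exp_zero, one_mul] at h
  simp_rw [val_bavg]
  refine h.congr_deriv ?_
  rw [Xhat_eq L hL, sub_add_cancel]

/-- **p. 20, the sentence after (15), AS A DERIVATIVE**: "taking `U = e^{iA}` with `A` small and expanding the logarithm
of the expression on the right-hand side above in powers of `A`, we get the expression (14) as a linear term in the
expansion" — for every bond field `A` on `ℤᵈ`, every `L ≥ 1` and every `L`-bond `c`, `t ↦ log Ū_c(e^{tA})` is
differentiable at `t = 0` with derivative `T_c = Σ_{x∈B(c₋)} L^{−d} A(Γ_{c,x})` (`= L·Ā_c`, next theorem). [cite: Balaban1985Averaging, p.20 (sentence after (15)), (14)–(15) p.19] -/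
theorem hasDerivAt_mlog_bavg_expCfg (hL : 1 ≤ L) (A : Site d → Fin d → 𝔸) (q : Site d) (κ : Fin d) :
    HasDerivAt (fun t : ℂ => mlog ((bavg L (expCfg (t • A)) q κ : 𝔸ˣ) : 𝔸)) (Tside L A q κ) 0 :=
  hasDerivAt_mlog_comp (by simp only [zero_smul, expCfg_zero, bavg_one, Units.val_one])
    (hasDerivAt_bavg_expCfg L hL A q κ)

/-- **The linear term of `log Ū_c(e^{tA})` is `L·Ā_c`**, `Ā_c` = (14) (the factor `L` = the length of `c`: (14) is
written in [2]'s function normalisation of fields on the `L`-lattice, `log Ū_c` is a bond variable). [cite: Balaban1985Averaging, p.20 (sentence after (15)), (14) p.19] -/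
theorem hasDerivAt_mlog_bavg_expCfg_linAvg (hL : 1 ≤ L) (A : Site d → Fin d → 𝔸) (q : Site d) (κ : Fin d) :
    HasDerivAt (fun t : ℂ => mlog ((bavg L (expCfg (t • A)) q κ : 𝔸ˣ) : 𝔸)) ((L : ℝ) • linAvg L A q κ) 0 := by
  rw [← Tside_eq_smul_linAvg L hL]
  exact hasDerivAt_mlog_bavg_expCfg L hL A q κ

/-- **The sentence with print's `i`**: for `U_s = e^{isA}`, `d/ds|₀ (1/i) log Ū_{s,c} = L·Ā_c` ("we demand that
`(1/i) log Ū` is well approximated by the linear averaging operation (1.8)", p. 19). [cite: Balaban1985Averaging, p.19–20 (sentences around (14)–(15))] -/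
theorem hasDerivAt_invI_smul_mlog_bavg (hL : 1 ≤ L) (A : Site d → Fin d → 𝔸) (q : Site d) (κ : Fin d) :
    HasDerivAt (fun s : ℂ => (Complex.I⁻¹ : ℂ) • mlog ((bavg L (expCfg (s • (Complex.I • A))) q κ : 𝔸ˣ) : 𝔸))
      ((L : ℝ) • linAvg L A q κ) 0 := by
  have h := (hasDerivAt_mlog_bavg_expCfg L hL (Complex.I • A) q κ).fun_const_smul (Complex.I⁻¹ : ℂ)
  refine h.congr_deriv ?_
  rw [Tside_csmul, smul_smul, inv_mul_cancel₀ Complex.I_ne_zero, one_smul, Tside_eq_smul_linAvg L hL]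

/-- The same over a REAL parameter (`A` in the real Lie algebra scaled by `s ∈ ℝ`): `d/ds|₀ (1/i) log Ū_c(e^{isA}) = L·Ā_c`.
[cite: Balaban1985Averaging, p.19–20 (sentences around (14)–(15))] -/
theorem hasDerivAt_invI_smul_mlog_bavg_real (hL : 1 ≤ L) (A : Site d → Fin d → 𝔸) (q : Site d) (κ : Fin d) :
    HasDerivAt (fun s : ℝ => (Complex.I⁻¹ : ℂ) • mlog ((bavg L (expCfg ((s : ℂ) • (Complex.I • A))) q κ : 𝔸ˣ) : 𝔸))
      ((L : ℝ) • linAvg L A q κ) 0 := by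
  have hf' : HasDerivAt
      (fun s : ℂ => (Complex.I⁻¹ : ℂ) • mlog ((bavg L (expCfg (s • (Complex.I • A))) q κ : 𝔸ˣ) : 𝔸))
      ((L : ℝ) • linAvg L A q κ) (Complex.ofRealCLM (0 : ℝ)) := by
    rw [Complex.ofRealCLM_apply, Complex.ofReal_zero]
    exact hasDerivAt_invI_smul_mlog_bavg L hL A q κ
  have h := HasDerivAt.scomp (0 : ℝ) hf' (Complex.ofRealCLM.hasDerivAt (x := (0 : ℝ)))
  simpa [Function.comp_def] using h

end Deriv

end Literature.MathematicalPhysics.QuantumFieldTheory.Balaban1983to89.B7Eq14LinearAverage
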